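import Mathlib
import HarnessLib
import Summits.HubbardSuperconductivity.HubbardSuperconductivity.Theorems.KLProgrammeKLRegimeEngineScaleZeroE4TorusSums
import Summits.HubbardSuperconductivity.HubbardSuperconductivity.Theorems.KLProgrammeKLRegimeEngineScaleZeroE4SpaceMoment
import Summits.HubbardSuperconductivity.HubbardSuperconductivity.Theorems.KLProgrammeKLRegimeEngineScaleZeroTimeMoment
import Summits.HubbardSuperconductivity.HubbardSuperconductivity.Theorems.KLProgrammeKLRegimeEngineScaleZeroValuesExplicit
import Summits.HubbardSuperconductivity.HubbardSuperconductivity.Theorems.KLProgrammeKLRegimeEngineScaleZeroE1Theta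
import Summits.HubbardSuperconductivity.HubbardSuperconductivity.Theorems.KLProgrammeKLRegimeEngineFramePosKernelMoment
import Summits.HubbardSuperconductivity.HubbardSuperconductivity.Theorems.KLProgrammeKLRegimeEngineScaleZeroE4OverlapTimeExplicit
import Summits.HubbardSuperconductivity.HubbardSuperconductivity.Theorems.KLProgrammeKLRegimeEngineIsoTorusDefs
import Summits.HubbardSuperconductivity.HubbardSuperconductivity.Theorems.KLProgrammeH10TwoPointLimitIsoTorusSum
import Summits.HubbardSuperconductivity.HubbardSuperconductivity.Theorems.KLProgrammeKLRegimeFrameShellCount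
import Summits.HubbardSuperconductivity.HubbardSuperconductivity.Theorems.KLProgrammeKLRegimeEngineScaleZeroE1Regime
import Summits.HubbardSuperconductivity.HubbardSuperconductivity.Theorems.KLProgrammeKLRegimeEngineScaleZeroE1Gfr0
import Summits.HubbardSuperconductivity.HubbardSuperconductivity.Theorems.KLProgrammeKLRegimeEngineScaleZeroResummedDecayKlEng
import Summits.HubbardSuperconductivity.HubbardSuperconductivity.Theorems.KLProgrammeKLRegimeSplitFrameExtFnConst
import Summits.HubbardSuperconductivity.HubbardSuperconductivity.Theorems.KLProgrammeH10TwoPointLimitFramePerturbation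

/-!
# K3 ENGINE child (`KLRegimeEngineV16`, stmt-HubbardSuperconductivity-20236), stub `stub_engine_scale0`, conjunct (E4)₀ — packaging PARTS:
# the weighted covariance torus sum `A_w`, the frame's weighted `ℓ¹` size `kK_w`, and the smallness `θ_w ≤ 1/2`

Cell `gate-hubbard-kl`, seat p4 (g9).  Inputs of the (E4)₀ packaging (`…ScaleZeroE4Package`, which feeds k3c2-p1's reduction
`firstMoment_zero_le_of_torusSums`, p501478):

* §1 `A_w`: **`plainTorusSum_scaleZero_le_A0`** — the PLAIN covariance torus sum in the grid units, the torus twin of k3c4-p2's `alpha_scaleZero_le`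
  (`sum_sum_norm_charSum_gridSymbol_uvSymbolCT_le` at the time rate `s₀ = β·klE0/N`, radicand algebra `radicand_scaleZero_eq`, constant `klScaleZeroA0` at
  `B₁ = 32/3`, `B₂ = 1110`); **`weightedSum_le_of_parts`** — the weight `1 + (β/N)|ã|_N + |b⃗|_∞` from the plain, time and two space parts.
* §2 **`frameKernel_weightedL1_le`**: `kK_w = Σ_z ‖Ǩ_L z‖·(1 + |z|_∞) ≤ klKappaFrameC R·|U| + 2·(N_sc+1)·U²·6(πGfr1/2 + π²Gfr2/(2√2) + π³Gfr3/8)`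
  (p3's `framePosKernel` `ℓ¹` size and first moments).
* §3 **`thetaW_scaleZero_le_half`**: `θ_w ≤ 1/2` from `16e⁵·Ā·k̄K ≤ 1` and `64e⁹κ₀²·Ā·|U| ≤ 1` (`theta_scaleZero_le_half`, generic in the degree-`2` size).

Everything is proved; no definitions, no named facts, no sorry.  Nothing asserts superconductivity.
-/

noncomputable section

namespace Summit.HubbardSuperconductivity.HubbardSuperconductivity.Theorems.EngineV8

set_option linter.dupNamespace false -- summit = problem name (single-conjunct summit), D-0017

open Real Finset Complex Literature.MathematicalPhysics.QuantumLattice Literature.Probability.LatticeModels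
open Literature.MathematicalPhysics.QuantumLattice.GrassmannAlgebra
open Summit.HubbardSuperconductivity.HubbardSuperconductivity.Theorems.KLRegimeSplit
open Summit.HubbardSuperconductivity.HubbardSuperconductivity.Theorems.DispersionFlow
open Summit.HubbardSuperconductivity.HubbardSuperconductivity.Theorems.KLProgrammeLegKernels
open Summit.HubbardSuperconductivity.HubbardSuperconductivity.Theorems.ScaleZeroDecay
open scoped ComplexConjugate

/-! ## §1 The weighted covariance torus sum `A_w` -/

section Alpha

variable {R : RenConsts} {U : ℝ} {Nsc : ℕ} {μ : ℝ} {K : TrigPolyC4v} {β : ℝ} {L M : ℕ} [NeZero L]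

/-- **The PLAIN covariance torus sum in the grid units** (torus twin of `alpha_scaleZero_le` at `B₁ = 32/3`, `B₂ = 1110`):
`(β/N)·Σ_{a,b⃗} ‖S[G_σ](a,b⃗)‖ ≤ klScaleZeroA0`, `N = 2(2M)`, for every admissible frame, `klBetaMin ≤ β`, `β³ ≤ M`. -/
theorem plainTorusSum_scaleZero_le_A0 [NeZero M] (hK : FrameOK R U Nsc μ K) (hβ : klBetaMin ≤ β) (hβM : β ^ 3 ≤ (M : ℝ))
    (σ : Fin 2) :
    β / (((2 * (2 * M) : ℕ) : ℝ)) * ∑ a : TorusSite 1 (2 * (2 * M)), ∑ bv : TorusSite 2 L,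
        ‖∑ q₀ : TorusSite 1 (2 * (2 * M)), ∑ qv : TorusSite 2 L, torusChar q₀ a * torusChar qv bv *
          gridSymbol L M (2 * (2 * M)) β (uvSymbolCT L M β μ K klE0) σ q₀ qv‖ ≤ klScaleZeroA0 := by
  haveI : NeZero (2 * (2 * M)) := ⟨by have := NeZero.ne M; omega⟩
  have hβ0 : 0 < β := beta_pos_of_klBetaMin_le hβ
  have hβ128 : (128 : ℝ) ≤ β := by simpa [klBetaMin] using hβ
  have hΛ : (0 : ℝ) < klE0 := by norm_num [klE0]
  have hL : (0 : ℝ) < L := by exact_mod_cast Nat.pos_of_ne_zero (NeZero.ne L)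
  have hβ3 : β ≤ β ^ 3 := by nlinarith [sq_nonneg β]
  have hMr : β ≤ (M : ℝ) := hβ3.trans hβM
  have hM2 : 2 ≤ M := by
    have : (2 : ℝ) ≤ M := by linarith
    exact_mod_cast this
  have hN4 : (((2 * (2 * M) : ℕ) : ℝ)) = 4 * M := by push_cast; ring
  have hN0 : 0 < (((2 * (2 * M) : ℕ) : ℝ)) := by rw [hN4]; positivity
  have hs₀pos : 0 < β * klE0 / (((2 * (2 * M) : ℕ) : ℝ)) := by positivity
  have htor := sum_sum_norm_charSum_gridSymbol_uvSymbolCT_le (L := L) (M := M) (N := 2 * (2 * M)) hβ0 hΛ klsv_B₁ klsv_B₂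
    (by norm_num : (0 : ℝ) ≤ 7) (uvLineBound_of_frameOK hK) hM2 (by omega) hs₀pos σ
  rw [show klScaleZeroA0 = 14 * Real.sqrt _ from rfl]
  refine mul_le_fourteen_sqrt_of_le htor (by positivity) (by positivity) ?_
  rw [radicand_scaleZero_eq hN0.ne' hL.ne' hβ0.ne' hΛ.ne' (by linarith)]
  refine mul_le_mul_of_nonneg_left ?_ (by norm_num)
  have h1 : 2 * β / (((2 * (2 * M) : ℕ) : ℝ)) + 12 / klE0 ≤ 1 / 2 + 12 / klE0 := by
    have : 2 * β / (((2 * (2 * M) : ℕ) : ℝ)) ≤ 1 / 2 := by rw [div_le_iff₀ hN0, hN4]; linarith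
    linarith
  have hT3 : 256 * Real.pi ^ 5 * (4 * (1110 : ℝ) + 6 * (32 / 3) + 2) ^ 2 / (β * klE0 ^ 2) ≤
      2 * Real.pi ^ 5 * (4 * (1110 : ℝ) + 6 * (32 / 3) + 2) ^ 2 / klE0 ^ 2 := by
    rw [div_le_div_iff₀ (by positivity) (by positivity)]
    have : 0 ≤ Real.pi ^ 5 * (4 * (1110 : ℝ) + 6 * (32 / 3) + 2) ^ 2 * klE0 ^ 2 := by positivity
    nlinarith
  have hT4 : β ^ 5 * klE0 ^ 4 / (4 * Real.pi ^ 2 * (2 * M - 3) ^ 2) ≤ 1 := by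
    have hM' : β ^ 3 ≤ 2 * (M : ℝ) - 3 := by linarith
    have h6 : (β ^ 3) ^ 2 ≤ (2 * (M : ℝ) - 3) ^ 2 := pow_le_pow_left₀ (by positivity) hM' 2
    have hπ2 : 9 ≤ Real.pi ^ 2 := by nlinarith [Real.pi_gt_three]
    have hden : (0 : ℝ) < 4 * Real.pi ^ 2 * (2 * M - 3) ^ 2 := by
      have : (0 : ℝ) < 2 * M - 3 := by linarith
      positivity
    rw [div_le_one hden, show klE0 ^ 4 = (1 : ℝ) / 2 ^ 20 by norm_num [klE0]]
    have hβ5 : β ^ 5 ≤ (β ^ 3) ^ 2 := by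
      rw [← pow_mul, show 3 * 2 = 5 + 1 from rfl, pow_succ]
      exact le_mul_of_one_le_right (by positivity) (by linarith)
    nlinarith [pow_pos hβ0 5]
  have hpos : 0 ≤ 2 / klE0 + 128 * Real.pi ^ 4 * (4 * (1110 : ℝ) + 6 * (32 / 3) + 2) ^ 2 / klE0 +
      256 * Real.pi ^ 5 * (4 * (1110 : ℝ) + 6 * (32 / 3) + 2) ^ 2 / (β * klE0 ^ 2) +
        β ^ 5 * klE0 ^ 4 / (4 * Real.pi ^ 2 * (2 * M - 3) ^ 2) +
      Real.pi ^ 4 * ((7 : ℝ) ^ 2 * (4 * (1110 : ℝ) + 6 * (32 / 3) + 2) * (2 / klE0) + 7 * (2 * (32 / 3) + 1)) ^ 2 / klE0 ^ 3 := by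
    have : (0 : ℝ) < 2 * M - 3 := by linarith
    positivity
  refine mul_le_mul h1 ?_ hpos (by positivity)
  linarith


/-- **Weighted from parts** (bookkeeping): if the plain, time-weighted and the two space-weighted torus sums of a nonnegative `f` are
`≤ A₀, A_T, A_X` in the grid units `β/N`, then `Σ_{a,b⃗} (1 + (β/N)|ã|_N + |b⃗|_∞)·f(a,b⃗) ≤ (N/β)·(A₀ + A_T + 2A_X)`
(`|ã|_N = cyclicDist`, `|b⃗|_∞ = torusSiteDist ≤ |b̃₀| + |b̃₁|`). -/
theorem weightedSum_le_of_parts {N : ℕ} [NeZero N] (hβ : 0 < β) (f : TorusSite 1 N → TorusSite 2 L → ℝ)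
    (hf : ∀ a bv, 0 ≤ f a bv) {A₀ AT AX : ℝ}
    (h0 : β / N * ∑ a : TorusSite 1 N, ∑ bv : TorusSite 2 L, f a bv ≤ A₀)
    (hT : β / N * ∑ a : TorusSite 1 N, ∑ bv : TorusSite 2 L, β / N * |(((a 0).valMinAbs : ℤ) : ℝ)| * f a bv ≤ AT)
    (hX : ∀ l : Fin 2, β / N * ∑ a : TorusSite 1 N, ∑ bv : TorusSite 2 L, |(((bv l).valMinAbs : ℤ) : ℝ)| * f a bv ≤ AX) :
    ∑ a : TorusSite 1 N, ∑ bv : TorusSite 2 L, (1 + (β / N * cyclicDist N (a 0) 0 + torusSiteDist bv 0)) * f a bv ≤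
      N / β * (A₀ + AT + 2 * AX) := by
  have hN : (0 : ℝ) < N := by exact_mod_cast Nat.pos_of_ne_zero (NeZero.ne N)
  have hβN : 0 < β / N := div_pos hβ hN
  -- pointwise split of the weight
  have hpt : ∀ (a : TorusSite 1 N) (bv : TorusSite 2 L),
      (1 + (β / N * cyclicDist N (a 0) 0 + torusSiteDist bv 0)) * f a bv ≤
        f a bv + β / N * |(((a 0).valMinAbs : ℤ) : ℝ)| * f a bv +
          (|(((bv 0).valMinAbs : ℤ) : ℝ)| * f a bv + |(((bv 1).valMinAbs : ℤ) : ℝ)| * f a bv) := by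
    intro a bv
    have hcd : cyclicDist N (a 0) 0 = |(((a 0).valMinAbs : ℤ) : ℝ)| := cyclicDist_zero_eq_abs_valMinAbs (a 0)
    have htd : torusSiteDist bv 0 ≤ |(((bv 0).valMinAbs : ℤ) : ℝ)| + |(((bv 1).valMinAbs : ℤ) : ℝ)| := by
      simpa using torusSiteDist_le_abs_add_abs bv 0
    have hf0 := hf a bv
    rw [hcd]
    nlinarith [mul_le_mul_of_nonneg_right htd hf0]
  have hsum := Finset.sum_le_sum fun a (_ : a ∈ univ) => Finset.sum_le_sum fun bv (_ : bv ∈ univ) => hpt a bv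
  refine hsum.trans ?_
  simp only [Finset.sum_add_distrib]
  -- the four parts in grid units
  have conv : ∀ {S A : ℝ}, β / N * S ≤ A → S ≤ N / β * A := by
    intro S A h
    have h' : S ≤ A / (β / N) := (le_div_iff₀' hβN).2 h
    calc S ≤ A / (β / N) := h'
      _ = N / β * A := by rw [div_div_eq_mul_div]; ring
  have e0 := conv h0
  have eT := conv hT
  have eX0 := conv (hX 0)
  have eX1 := conv (hX 1)
  nlinarith [e0, eT, eX0, eX1]

end Alpha

/-! ## §2 The weighted `ℓ¹` size `kK_w` of the frame's position kernel -/

section Frame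

variable {R : RenConsts} {U : ℝ} {Nsc : ℕ} {μ : ℝ} {K : TrigPolyC4v} {L : ℕ} [NeZero L]

/-- **`kK_w = Σ_z ‖Ǩ_L z‖·(1 + |z|_∞) ≤ klKappaFrameC R·|U| + 2·(N_sc+1)·U²·6(πGfr1/2 + π²Gfr2/(2√2) + π³Gfr3/8)`** for every admissible frame
(`|U| ≤ 1`): p3's intrinsic `ℓ¹` constant plus p3's first moments in the two lattice directions (`|z|_∞ ≤ |z̃₀| + |z̃₁|`). -/
theorem frameKernel_weightedL1_le (hR : R.WF) (hU0 : U ≠ 0) (hU1 : |U| ≤ 1) (hK : FrameOK R U Nsc μ K) :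
    ∑ z : TorusSite 2 L, ‖framePosKernel L K z‖ * (1 + torusSiteDist z 0) ≤
      klKappaFrameC R * |U| + 2 * (((Nsc : ℝ) + 1) * U ^ 2 *
        (6 * (Real.pi * R.Gfr 1 / 2 + Real.pi ^ 2 * R.Gfr 2 / (2 * Real.sqrt 2) + Real.pi ^ 3 * R.Gfr 3 / 8))) := by
  have hpt : ∀ z : TorusSite 2 L, ‖framePosKernel L K z‖ * (1 + torusSiteDist z 0) ≤
      ‖framePosKernel L K z‖ + (|(((z 0).valMinAbs : ℤ) : ℝ)| * ‖framePosKernel L K z‖ +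
        |(((z 1).valMinAbs : ℤ) : ℝ)| * ‖framePosKernel L K z‖) := by
    intro z
    have htd : torusSiteDist z 0 ≤ |(((z 0).valMinAbs : ℤ) : ℝ)| + |(((z 1).valMinAbs : ℤ) : ℝ)| := by
      simpa using torusSiteDist_le_abs_add_abs z 0
    have h0 := norm_nonneg (framePosKernel L K z)
    nlinarith [mul_le_mul_of_nonneg_left htd h0]
  refine (Finset.sum_le_sum fun z _ => hpt z).trans ?_
  rw [Finset.sum_add_distrib, Finset.sum_add_distrib]
  have h1 := sum_norm_framePosKernel_le_linear_of_frameOK (L := L) hR hU0 hU1 hK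
  have h2 := sum_abs_mul_norm_framePosKernel_le_of_frameOK (L := L) hR.2.2 hK 0
  have h3 := sum_abs_mul_norm_framePosKernel_le_of_frameOK (L := L) hR.2.2 hK 1
  have hκ : (256 : ℝ) * ((4 / 3) * Real.sqrt (24 * Real.pi ^ 2 * (R.Gfr 0 + 1) * (R.Gfr 2 + 1)) + (128 / 15) * (R.Gfr 0 + 1)) * |U| =
      klKappaFrameC R * |U| := by rw [klKappaFrameC]
  linarith

end Frame

/-! ## §3 The smallness `θ_w ≤ 1/2` of the weighted scale-`0` step -/

section Theta

variable {L M : ℕ} [NeZero L]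

/-- **`θ_w ≤ 1/2` from two smallness conditions**: with `A_w = 4M·Ā/β`, `κ = ρ = κ₀ = √(2(7+6047))` and the weighted vertex size
`N_w(1) = (|β|/N)·kK_w`, `N_w(2) = |U||β|/N`: if `kK_w ≤ k̄K`, `16e⁵·Ā·k̄K ≤ 1` and `64e⁹κ₀²·Ā·|U| ≤ 1` then `θ_w ≤ 1/2`
(`theta_scaleZero_le_half`, which is generic in the degree-`2` size). -/
theorem thetaW_scaleZero_le_half [NeZero M] {β : ℝ} (hβ : 0 < β) {U Abar kKbar : ℝ} (K : TrigPolyC4v) (hA0 : 0 ≤ Abar)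
    (hkK : ∑ z : TorusSite 2 L, ‖framePosKernel L K z‖ * (1 + torusSiteDist z 0) ≤ kKbar)
    (h1 : 16 * Real.exp 1 ^ 5 * Abar * kKbar ≤ 1) (h2 : 64 * Real.exp 1 ^ 9 * Real.sqrt (2 * (7 + 6047)) ^ 2 * Abar * |U| ≤ 1) :
    Real.exp 1 * (4 * M * Abar / β) *
        normV (GridLeg (GridPoint L (2 * (2 * M)))) (Real.sqrt (2 * (7 + 6047))) (Real.sqrt (2 * (7 + 6047)))
          ((fun m' : ℕ => if m' = 1 then |β| / (2 * (2 * M) : ℕ) * ∑ z : TorusSite 2 L, ‖framePosKernel L K z‖ * (1 + torusSiteDist z 0)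
            else if m' = 2 then |U| * |β| / (2 * (2 * M) : ℕ) else 0)) /
        Real.sqrt (2 * (7 + 6047)) ^ 2 ≤ 1 / 2 := by
  have h1' : 16 * Real.exp 1 ^ 5 * Abar * (∑ z : TorusSite 2 L, ‖framePosKernel L K z‖ * (1 + torusSiteDist z 0)) ≤ 1 := by
    have h16 : 0 ≤ 16 * Real.exp 1 ^ 5 * Abar := by positivity
    exact (mul_le_mul_of_nonneg_left hkK h16).trans h1
  exact theta_scaleZero_le_half (L := L) hβ h1' h2

end Theta

end Summit.HubbardSuperconductivity.HubbardSuperconductivity.Theorems.EngineV8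

end
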